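/-
Copyright (c) 2026 the pub-hodgecm-mathlib formalisation cell (harness21).  Prover seat hodgecm-mathlib-K2Liu-p11 (g0), Track B «K2-LIT»,
#184♮ = hLiu418 = `stmt-HodgeConjecture-24832`; LEAD F0P6-plan (g12) RULING M-156n (4) «A∞ ORGAN»; K2E5-plan (g6) 08:24:53Z «=».
File (A∞-0b): the (D∞) letters folded — the scalar-type vector is a Siegel section with its `K_w`-type, and the intertwining integrand at
the base point.  THEOREMS ONLY (no `def`, no `instance`, no notation, no named-fact hypothesis, no `sorry`).
-/
import Summits.HodgeConjecture.HodgeConjecture.Theorems.K2LiuArchInducedTubeDefs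
import Summits.HodgeConjecture.HodgeConjecture.Theorems.K2LiuArchInducedTubeSectionPrelims
import HarnessLib

/-!
# Crux `HLiu418`, A∞ organ, (A∞-0b): `archScalarSection k s ∈ I_w(s, χ_k)`, its `K_w`-type, and `M_w f⁰ (1)` as the base integral

Cell `hodgecm-mathlib`, crux item hLiu418 = `stmt-HodgeConjecture-24832` (helper lane `--supports`, count-neutral).
* `isArchSiegelSection_archScalarSection` — `f⁰_{s,k} = archScalarSection k s` satisfies the parabolic law of `I_w(s, χ_k)`,
  `χ_k(z) = (z̄ ∕ ‖z‖)^k` (★ (A∞-0a) `scalarSection_parabolic`);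
* `archScalarSection_mul_stab` — `f⁰(g u) = j(u,i1)^{−k} f⁰(g)` for `u ∈ Stab(i·1) ∩ U(J)` (★ `scalarSection_mul_stab`);
* `denom_J_mul_transl` — `denom (J · transl b · g) (i1) = num g (i1) + b · denom g (i1)`; at `g = 1`: `= b + i·1`; hence
  `archIntertwining_archScalarSection_one`: `M_w f⁰_{s,k} (1) = ∫ r, det(hermOfReal r + i·1)^{−k} · ‖det(hermOfReal r + i·1)‖^{k−2s−l}` —
  the base Γ-integral that (A∞-B) evaluates at `l = Fin 2`.
References: [Shimura1997, §16].
HONEST LABEL: HC_CM is proved only modulo the 7 printed citations (2 remaining named inputs: hLiu418 = stmt-HodgeConjecture-24832,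
h413 = stmt-HodgeConjecture-24833) until rung 0 closes; count-neutral helper, closes no socket.
-/

set_option autoImplicit false
set_option linter.dupNamespace false

noncomputable section

open scoped Matrix ComplexConjugate ComplexOrder
open Complex Matrix MeasureTheory
open Literature.NumberTheory.ModularForms.SiegelUpperHalfSpace (num denom moeb num_def denom_def denom_mul num_mul)
open Summit.HodgeConjecture.HodgeConjecture.Cruxes.HLiu418.K2LiuHermitianTubeCocycle
open Summit.HodgeConjecture.HodgeConjecture.Cruxes.HLiu418.K2LiuArchInducedTubeDefs
open Summit.HodgeConjecture.HodgeConjecture.Cruxes.HLiu418.K2LiuArchInducedTubeSectionPrelims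

namespace Summit.HodgeConjecture.HodgeConjecture.Cruxes.HLiu418.K2LiuArchInducedTubeSection

variable {l : Type*} [Fintype l] [DecidableEq l]

/-- **`archScalarSection k s ∈ I_w(s, χ_k)`**, `χ_k(z) = (z̄ ∕ ‖z‖)^k`. [cite: Shimura1997, §16.4] -/
theorem isArchSiegelSection_archScalarSection (k : ℤ) (s : ℂ) :
    IsArchSiegelSection (l := l) (fun z : ℂ => (conj z / ((‖z‖ : ℝ) : ℂ)) ^ k) s (archScalarSection k s) := by
  intro p g hP hp
  rw [archScalarSection_apply, archScalarSection_apply]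
  exact scalarSection_parabolic k s hP hp g

/-- **`K_w`-type of the scalar-type vector**: `f⁰(g u) = j(u,i1)^{−k} f⁰(g)` for `g ∈ U(J)`, `u ∈ U(J) ∩ Stab(i·1)`. [cite: Shimura1997, §16.4] -/
theorem archScalarSection_mul_stab (k : ℤ) (s : ℂ) {g u : Matrix (l ⊕ l) (l ⊕ l) ℂ} (hg : gᴴ * Matrix.J l ℂ * g = Matrix.J l ℂ)
    (hU : uᴴ * Matrix.J l ℂ * u = Matrix.J l ℂ) (hI : moeb u (I • (1 : Matrix l l ℂ)) = I • 1) :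
    archScalarSection k s (g * u) = (denom u (I • (1 : Matrix l l ℂ))).det ^ (-k) * archScalarSection k s g := by
  rw [archScalarSection_apply, archScalarSection_apply]
  exact scalarSection_mul_stab k s hg hU hI

/-- The automorphy matrix of `J · transl b · g`: `denom (J · transl b · g) Z = num g Z + b · denom g Z`. [cite: Shimura1997, §5.2] -/
theorem denom_J_mul_transl (b : Matrix l l ℂ) (g : Matrix (l ⊕ l) (l ⊕ l) ℂ) (Z : Matrix l l ℂ) :
    denom (Matrix.J l ℂ * fromBlocks 1 b 0 1 * g) Z = num g Z + b * denom g Z := by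
  have hJt : Matrix.J l ℂ * fromBlocks 1 b 0 1 = fromBlocks 0 (-1) 1 b := by
    rw [Matrix.J, fromBlocks_multiply]
    simp
  rw [hJt, denom_mul, toBlocks_fromBlocks₂₁, toBlocks_fromBlocks₂₂, Matrix.one_mul]

/-- At the identity: `denom (J · transl b) (i1) = b + i·1`. [cite: Shimura1997, §5.2] -/
theorem denom_J_mul_transl_one (b : Matrix l l ℂ) :
    denom (Matrix.J l ℂ * fromBlocks 1 b 0 1 * 1) (I • (1 : Matrix l l ℂ)) = b + I • 1 := by
  rw [denom_J_mul_transl, num_def, denom_def, ← fromBlocks_one, toBlocks_fromBlocks₁₁, toBlocks_fromBlocks₁₂, toBlocks_fromBlocks₂₁,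
    toBlocks_fromBlocks₂₂, Matrix.one_mul, add_zero, Matrix.zero_mul, zero_add, Matrix.mul_one, add_comm]

/-- **`M_w f⁰_{s,k} (1)` is the base integral** `∫ r, det(hermOfReal r + i·1)^{−k} · ‖det(hermOfReal r + i·1)‖^{k−2s−l}`.
[cite: Shimura1997, §16] -/
theorem archIntertwining_archScalarSection_one (k : ℤ) (s : ℂ) :
    archIntertwining (archScalarSection k s) (1 : Matrix (l ⊕ l) (l ⊕ l) ℂ) =
      ∫ r : l → l → ℝ, (hermOfReal r + I • (1 : Matrix l l ℂ)).det ^ (-k) *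
        (((‖(hermOfReal r + I • (1 : Matrix l l ℂ)).det‖ : ℝ) : ℂ) ^ ((k : ℂ) - 2 * s - (Fintype.card l : ℂ))) := by
  rw [archIntertwining_apply]
  refine integral_congr_ae (Filter.Eventually.of_forall fun r => ?_)
  simp only
  rw [archScalarSection_apply, denom_J_mul_transl_one]

end Summit.HodgeConjecture.HodgeConjecture.Cruxes.HLiu418.K2LiuArchInducedTubeSection

end
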